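import Literature.Topology.FourManifolds.HandlebodyClassification
import HarnessLib

/-!
# Cutting a handlebody stage at a prescribed level below its top critical point

Topic `Literature/Topology/FourManifolds` (fact seat
`provefact-Literature.Topology.FourManifolds.IsHandlebody.exists_isBoundaryGluing_sphere`, step F2b of
the Lickorish–Wallace DAG; bookkeeping for the induction proving the classification of
handlebodies `IsHandlebody.nonempty_diffeomorph` *with a level-compatibility invariant*).
Everything here is **proved**; no named facts.

`HandlebodyClassification.lean` cuts a stage `s` of genus `j + 1` (`HandlebodyStage.exists_cut`)
below its top critical point `p` at *some* regular level `a`, returning an abstract stage `t`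
with `IsHandleAttachment 2 1 t.X s.X`.  The handle-extension step of the level-compatible
induction needs more: the level `a` must be **prescribed** (at a common distance below the top
critical values of the two stages being compared), and the cut stage must be the concrete
sublevel set `{f ≤ a}` with its structure `sublevelAtlas` (`RegularSublevelSet.lean`) and the
function `f + (1 - a)`, so that smooth maps into it can be recognised
(`HalfSliceAtlas.contMDiffAt_codRestrict`).  This file provides exactly that:

* `HandlebodyStage.exists_top` — the top critical point `p` of a stage of genus `j + 1`: of
  index `1`, with `f p < 1`, all other critical values `≤ β` for some `β < f p`;
* `HandlebodyStage.cut s …` — for a level `a` with `f q < a < f p` for all critical `q ≠ p`, the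
  **cut stage** on `↥(f ⁻¹' Iic a)` (structure `HandlebodyStage.cutAtlas = sublevelAtlas …`,
  function `fun x => f x + (1 - a)`), with `cut_X`, `cut_f` (`rfl`), `genus_cut`.

## References

* J. Milnor, *Lectures on the h-cobordism theorem* (1965), Lemmas 2.8–2.9, Cor. 2.10.
  [MilnorHCobordism1965]
* A. Kosinski, *Differential Manifolds* (1993), VII §§1–2. [Kosinski1993]
-/

open scoped Manifold ContDiff Topology
open Set Function Filter

noncomputable section

namespace Literature.Topology.FourManifolds

universe u

attribute [local instance] HandlebodyStage.top HandlebodyStage.t2 HandlebodyStage.sc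
  HandlebodyStage.cpt HandlebodyStage.conn HandlebodyStage.cs HandlebodyStage.mfd

namespace HandlebodyStage

/-- **The top critical point of a stage of positive genus**: a critical point `p` of index `1`
with `f p < 1` and a bound `β < f p` for all other critical values (the critical values are
distinct). [cite: MilnorHCobordism1965, Lemma 2.8 and Cor. 2.10] -/
theorem exists_top (s : HandlebodyStage.{u}) {j : ℕ} (hj : s.genus = j + 1) :
    ∃ (p : s.X) (β : ℝ), IsMCriticalPt (𝓡∂ 3) s.f p ∧ morseIndex (𝓡∂ 3) s.f p = 1 ∧
      β < s.f p ∧ s.f p < 1 ∧ ∀ q, IsMCriticalPt (𝓡∂ 3) s.f q → q ≠ p → s.f q ≤ β := by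
  obtain ⟨p₀, hp₀⟩ := s.exists_criticalSetOfIndex_zero_eq
  have hp₀mem : p₀ ∈ criticalSetOfIndex (𝓡∂ 3) s.f 0 := by rw [hp₀]; exact mem_singleton _
  have hne : (criticalSet (𝓡∂ 3) s.f).Nonempty := ⟨p₀, hp₀mem.1⟩
  obtain ⟨p, hpC, hpmax⟩ :=
    (criticalSet (𝓡∂ 3) s.f).exists_max_image s.f s.finite_criticalSet hne
  have hp1 : s.f p < 1 := s.adapted.2.2 p (s.isInteriorPoint_of_isMCriticalPt hpC)
  have hq : (criticalSetOfIndex (𝓡∂ 3) s.f 1).Nonempty :=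
    nonempty_of_ncard_ne_zero (by rw [show (criticalSetOfIndex (𝓡∂ 3) s.f 1).ncard = j + 1 from hj]; omega)
  obtain ⟨q, hq⟩ := hq
  have hqp₀ : q ≠ p₀ := fun h => by
    have h0 := hp₀mem.2; have h1 := hq.2; rw [h] at h1; rw [h1] at h0; exact one_ne_zero h0
  have hpp₀ : p ≠ p₀ := fun h => by
    have hlt := s.apply_lt_of_isMCriticalPt hp₀ hq.1 hqp₀
    have hle := hpmax q hq.1
    rw [h] at hle
    exact absurd (hlt.trans_le hle) (lt_irrefl _)
  have hpidx : morseIndex (𝓡∂ 3) s.f p = 1 := by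
    have hle := s.morseIndex_le_one p hpC
    rcases Nat.lt_or_ge (morseIndex (𝓡∂ 3) s.f p) 1 with h0 | h0
    · exfalso
      have : p ∈ criticalSetOfIndex (𝓡∂ 3) s.f 0 := ⟨hpC, by omega⟩
      rw [hp₀] at this
      exact hpp₀ this
    · exact le_antisymm hle h0
  obtain ⟨β, hβB, hβmax⟩ :=
    (insert (s.f p - 1) (s.f '' (criticalSet (𝓡∂ 3) s.f \ {p}))).exists_max_image id
      (((s.finite_criticalSet.sdiff).image _).insert _) ⟨_, mem_insert _ _⟩
  have hβ : β < s.f p := by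
    rcases hβB with rfl | ⟨q', ⟨hqC, hqp⟩, rfl⟩
    · linarith
    · exact lt_of_le_of_ne (hpmax q' hqC) fun heq => hqp (s.injOn_criticalSet hqC hpC heq)
  exact ⟨p, β, hpC, hpidx, hβ, hp1, fun q' hq' hqp =>
    hβmax (s.f q') (mem_insert_of_mem _ ⟨q', ⟨hq', hqp⟩, rfl⟩)⟩

/-- The data of a cut: a critical point `p` of index `1` and a level `a` with `f q < a < f p`
for every critical point `q ≠ p`. [folklore] -/
structure CutData (s : HandlebodyStage.{u}) where
  /-- The top critical point. -/
  p : s.X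
  /-- The cut level. -/
  a : ℝ
  isMCriticalPt : IsMCriticalPt (𝓡∂ 3) s.f p
  morseIndex_eq : morseIndex (𝓡∂ 3) s.f p = 1
  lt_apply : a < s.f p
  apply_lt : ∀ q, IsMCriticalPt (𝓡∂ 3) s.f q → q ≠ p → s.f q < a

namespace CutData

variable {s : HandlebodyStage.{u}} (d : s.CutData)

/-- The cut level is below `1`. [folklore] -/
theorem a_lt_one : d.a < 1 :=
  d.lt_apply.trans (s.adapted.2.2 d.p (s.isInteriorPoint_of_isMCriticalPt d.isMCriticalPt))

/-- No critical value equals the cut level. [folklore] -/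
theorem apply_ne (z : s.X) (hz : IsMCriticalPt (𝓡∂ 3) s.f z) : s.f z ≠ d.a := by
  intro hza
  by_cases hzp : z = d.p
  · exact absurd hza (by rw [hzp]; exact d.lt_apply.ne')
  · exact (d.apply_lt z hz hzp).ne hza

/-- The points of `{f ≤ a}` are interior points. [folklore] -/
theorem isInteriorPoint_of_le (q : s.X) (hq : s.f q ≤ d.a) : (𝓡∂ 3).IsInteriorPoint q :=
  ((𝓡∂ 3).isInteriorPoint_iff_not_isBoundaryPoint q).2 fun hb => by
    have := (s.adapted.2.1 q hb).1; linarith [d.a_lt_one]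

/-- No critical point lies on the level `{f = a}`. [folklore] -/
theorem not_isMCriticalPt_of_eq (q : s.X) (hq : s.f q = d.a) : ¬ IsMCriticalPt (𝓡∂ 3) s.f q :=
  fun hc => d.apply_ne q hc hq

/-- The index-`0` critical point lies below the cut level. [folklore] -/
theorem apply_indexZero_le {p₀ : s.X} (hp₀ : criticalSetOfIndex (𝓡∂ 3) s.f 0 = {p₀}) :
    s.f p₀ ≤ d.a := by
  have hp₀mem : p₀ ∈ criticalSetOfIndex (𝓡∂ 3) s.f 0 := by rw [hp₀]; exact mem_singleton _
  have hp₀p : p₀ ≠ d.p := fun h => by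
    have h0 := hp₀mem.2
    rw [h, d.morseIndex_eq] at h0
    exact one_ne_zero h0
  exact (d.apply_lt p₀ hp₀mem.1 hp₀p).le

/-- **The half-slice atlas of the cut** (`sublevelAtlas` of `RegularSublevelSet.lean`).
[cite: MilnorHCobordism1965, Lemma 2.9] -/
def atlas : HalfSliceAtlas (𝓡∂ 3) (s.f ⁻¹' Iic d.a) :=
  letI : ChartedSpace (EuclideanHalfSpace (2 + 1)) s.X := s.cs
  haveI : IsManifold (𝓡∂ (2 + 1)) ∞ s.X := s.mfd
  sublevelAtlas (k := 2) (M := s.X) s.adapted.1.1 d.a d.isInteriorPoint_of_le d.not_isMCriticalPt_of_eq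

/-- **Milnor's Lemma 2.9 for the cut** (`sublevel_morseData`): with the structure `d.atlas`,
`{f ≤ a}` is a smooth manifold with boundary, the inclusion is a smooth embedding,
`f + (1 - a)` is adapted Morse with the critical points of `f` in `{f ≤ a}` and the same
indices. [cite: MilnorHCobordism1965, Lemma 2.9] -/
theorem morseData :
    letI := d.atlas.chartedSpace
    IsManifold (𝓡∂ 3) ∞ ↥(s.f ⁻¹' Iic d.a) ∧
      Manifold.IsSmoothEmbedding (𝓡∂ 3) (𝓡∂ 3) ∞ (Subtype.val : ↥(s.f ⁻¹' Iic d.a) → s.X) ∧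
      IsMorseAdapted (𝓡∂ 3) (fun x : ↥(s.f ⁻¹' Iic d.a) => s.f x + (1 - d.a)) ∧
      (∀ x : ↥(s.f ⁻¹' Iic d.a),
        IsMCriticalPt (𝓡∂ 3) (fun x : ↥(s.f ⁻¹' Iic d.a) => s.f x + (1 - d.a)) x ↔
          IsMCriticalPt (𝓡∂ 3) s.f x.1) ∧
      (∀ x : ↥(s.f ⁻¹' Iic d.a), IsMCriticalPt (𝓡∂ 3) s.f x.1 →
        morseIndex (𝓡∂ 3) (fun x : ↥(s.f ⁻¹' Iic d.a) => s.f x + (1 - d.a)) x =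
          morseIndex (𝓡∂ 3) s.f x.1) := by
  letI : ChartedSpace (EuclideanHalfSpace (2 + 1)) s.X := s.cs
  haveI : IsManifold (𝓡∂ (2 + 1)) ∞ s.X := s.mfd
  exact (sublevel_morseData (k := 2) (M := s.X) (by norm_num) s.adapted d.a_lt_one d.apply_ne).2.2

/-- The critical set of `f + (1 - a)` on the cut: the critical points of `f` other than `p`.
[folklore] -/
theorem criticalSet_eq :
    letI := d.atlas.chartedSpace
    criticalSet (𝓡∂ 3) (fun x : ↥(s.f ⁻¹' Iic d.a) => s.f x + (1 - d.a)) =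
      Subtype.val ⁻¹' (criticalSet (𝓡∂ 3) s.f \ {d.p}) := by
  letI := d.atlas.chartedSpace
  obtain ⟨-, -, -, hcrit, -⟩ := d.morseData
  ext x
  simp only [mem_criticalSet, mem_preimage, Set.mem_sdiff, mem_singleton_iff]
  rw [hcrit x]
  refine ⟨fun h => ⟨h, fun hx => ?_⟩, fun h => h.1⟩
  have : s.f d.p ≤ d.a := by simpa [hx] using x.2
  exact absurd this (not_le.2 d.lt_apply)

/-- The critical points of index `k` of `f + (1 - a)` on the cut. [folklore] -/
theorem criticalSetOfIndex_eq (k : ℕ) :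
    letI := d.atlas.chartedSpace
    criticalSetOfIndex (𝓡∂ 3) (fun x : ↥(s.f ⁻¹' Iic d.a) => s.f x + (1 - d.a)) k =
      Subtype.val ⁻¹' (criticalSetOfIndex (𝓡∂ 3) s.f k \ {d.p}) := by
  letI := d.atlas.chartedSpace
  obtain ⟨-, -, -, hcrit, hidx⟩ := d.morseData
  have hcritS := d.criticalSet_eq
  ext x
  simp only [mem_criticalSetOfIndex, mem_preimage, Set.mem_sdiff, mem_singleton_iff]
  constructor
  · rintro ⟨hx, hxk⟩
    have hx' : x ∈ criticalSet (𝓡∂ 3) (fun x : ↥(s.f ⁻¹' Iic d.a) => s.f x + (1 - d.a)) := hx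
    rw [hcritS] at hx'
    exact ⟨⟨hx'.1, by rw [← hidx x hx'.1]; exact hxk⟩, hx'.2⟩
  · rintro ⟨⟨hx, hxk⟩, hxp⟩
    exact ⟨(hcrit x).2 hx, by rw [hidx x hx]; exact hxk⟩

/-- **The cut stage** `{f ≤ a}` (Milnor 1965, Lemma 2.9 and proof of Cor. 2.10; same
construction as `HandlebodyStage.exists_cut`, at the prescribed level `d.a` and with the
definite structure `d.atlas`): connected by `IsMorseAdapted.isConnected_preimage_Iic`,
orientable by pull-back along the inclusion, one critical point of index `0`, all of index
`≤ 1`. [cite: MilnorHCobordism1965, Lemma 2.9 and Cor. 2.10] -/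
def cut : HandlebodyStage.{u} :=
  letI cs' := d.atlas.chartedSpace
  haveI : IsManifold (𝓡∂ 3) ∞ ↥(s.f ⁻¹' Iic d.a) := d.morseData.1
  haveI : CompactSpace ↥(s.f ⁻¹' Iic d.a) := isCompact_iff_compactSpace.1
    ((isClosed_le s.adapted.1.1.continuous continuous_const).isCompact)
  haveI : ConnectedSpace ↥(s.f ⁻¹' Iic d.a) := by
    obtain ⟨p₀, hp₀⟩ := s.exists_criticalSetOfIndex_zero_eq
    have h0s : (criticalSetOfIndex (𝓡∂ 3) s.f 0).Subsingleton := by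
      rw [hp₀]; exact subsingleton_singleton
    exact isConnected_iff_connectedSpace.1
      (s.adapted.isConnected_preimage_Iic h0s d.a_lt_one ⟨p₀, d.apply_indexZero_le hp₀⟩)
  { X := ↥(s.f ⁻¹' Iic d.a)
    orientable := IsOrientable.of_isSmoothEmbedding d.morseData.2.1 s.orientable
    f := fun x => s.f x + (1 - d.a)
    adapted := d.morseData.2.2.1
    injOn_criticalSet := by
      intro x hx y hy hxy
      rw [d.criticalSet_eq] at hx hy
      have hxy' : s.f x.1 = s.f y.1 := by simpa using hxy
      exact Subtype.val_injective (s.injOn_criticalSet hx.1 hy.1 hxy')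
    ncard_zero := by
      obtain ⟨p₀, hp₀⟩ := s.exists_criticalSetOfIndex_zero_eq
      have hp₀mem : p₀ ∈ criticalSetOfIndex (𝓡∂ 3) s.f 0 := by rw [hp₀]; exact mem_singleton _
      have hp₀p : p₀ ≠ d.p := fun h => by
        have h0 := hp₀mem.2
        rw [h, d.morseIndex_eq] at h0
        exact one_ne_zero h0
      have h0 : criticalSetOfIndex (𝓡∂ 3) (fun x : ↥(s.f ⁻¹' Iic d.a) => s.f x + (1 - d.a)) 0 =
          Subtype.val ⁻¹' {p₀} := by
        rw [d.criticalSetOfIndex_eq 0, hp₀]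
        congr 1
        ext z
        simp only [Set.mem_sdiff, mem_singleton_iff]
        exact ⟨fun h => h.1, fun h => ⟨h, fun h' => hp₀p (h.symm.trans h')⟩⟩
      rw [h0, ncard_preimage_of_injective_subset_range Subtype.val_injective
        (fun x hx => ⟨⟨p₀, d.apply_indexZero_le hp₀⟩, (mem_singleton_iff.1 hx).symm⟩),
        ncard_singleton]
    morseIndex_le_one := fun z hz => by
      have hz' : z ∈ criticalSet (𝓡∂ 3) (fun x : ↥(s.f ⁻¹' Iic d.a) => s.f x + (1 - d.a)) := hz
      rw [d.criticalSet_eq] at hz'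
      rw [d.morseData.2.2.2.2 z hz'.1]
      exact s.morseIndex_le_one z.1 hz'.1 }

/-- The carrier of the cut stage is the sublevel set (definitional). [folklore] -/
theorem cut_X : d.cut.X = ↥(s.f ⁻¹' Iic d.a) := rfl

/-- The Morse function of the cut stage is `f + (1 - a)` (definitional). [folklore] -/
theorem cut_f : d.cut.f = fun x : ↥(s.f ⁻¹' Iic d.a) => s.f x + (1 - d.a) := rfl

/-- The charts of the cut stage are those of `d.atlas` (definitional). [folklore] -/
theorem cut_cs : d.cut.cs = d.atlas.chartedSpace := rfl

/-- **The genus drops by one.** [cite: MilnorHCobordism1965, Cor. 2.10] -/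
theorem genus_cut_add_one : d.cut.genus + 1 = s.genus := by
  have hpmem : d.p ∈ criticalSetOfIndex (𝓡∂ 3) s.f 1 := ⟨d.isMCriticalPt, d.morseIndex_eq⟩
  have h := ncard_sdiff_singleton_add_one hpmem (s.finite_criticalSetOfIndex 1)
  have hsub : criticalSetOfIndex (𝓡∂ 3) s.f 1 \ {d.p} ⊆
      range (Subtype.val : ↥(s.f ⁻¹' Iic d.a) → s.X) := by
    rintro q ⟨hq, hqp⟩
    exact ⟨⟨q, (d.apply_lt q hq.1 hqp).le⟩, rfl⟩
  show (criticalSetOfIndex (𝓡∂ 3) d.cut.f 1).ncard + 1 = (criticalSetOfIndex (𝓡∂ 3) s.f 1).ncard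
  have h1 : criticalSetOfIndex (𝓡∂ 3) d.cut.f 1 =
      Subtype.val ⁻¹' (criticalSetOfIndex (𝓡∂ 3) s.f 1 \ {d.p}) := d.criticalSetOfIndex_eq 1
  rw [h1, ← h]
  congr 1
  exact ncard_preimage_of_injective_subset_range Subtype.val_injective hsub

end CutData

/-- **Every stage of positive genus can be cut at any level close enough below its top critical
value**: there are the top critical point `p` (index `1`) and `β < f p` such that every
`a ∈ (β, f p)` is a cut level. [cite: MilnorHCobordism1965, Lemma 2.8 and Cor. 2.10] -/
theorem exists_cutData (s : HandlebodyStage.{u}) {j : ℕ} (hj : s.genus = j + 1) :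
    ∃ (p : s.X) (β : ℝ), IsMCriticalPt (𝓡∂ 3) s.f p ∧ morseIndex (𝓡∂ 3) s.f p = 1 ∧ β < s.f p ∧
      ∀ a, β < a → a < s.f p → ∃ d : s.CutData, d.p = p ∧ d.a = a := by
  obtain ⟨p, β, hp, hp1, hβ, -, hle⟩ := s.exists_top hj
  exact ⟨p, β, hp, hp1, hβ, fun a hβa hap =>
    ⟨⟨p, a, hp, hp1, hap, fun q hq hqp => (hle q hq hqp).trans_lt hβa⟩, rfl, rfl⟩⟩

end HandlebodyStage

end Literature.Topology.FourManifolds
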